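import Literature.Analysis.FunctionSpaces.SobolevCompleteness
import Literature.Analysis.FunctionSpaces.SobolevDomainGNSProofs
import HarnessLib

/-!
# The chain rule `D|u|² = 2 ⟪u, Du⟫` for `u ∈ W^{1,2}(Ω)`

Analysis/FunctionSpaces support file (all results proved). It serves the decomposition of the
named fact `Literature.Analysis.FluidPDE.LemarieRieusset2016.lemma13_4` (Lemarié-Rieusset 2016,
Lemma 13.4) through Lemma 13.3, whose proof (§13.9, Step 1, p. 468, before (13.26), and p. 469
for (13.29)) applies the Poincaré–Sobolev inequality with `p = 1` to `|u(s)|²` on balls: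
"`(∫_{B(x,ρ)} ||u(s,y)|² - Γ_ρ|^{3/2} dy)^{2/3} ≤ C ∫_{B(x,ρ)} |∇(|u(s,y)|²)| dy` so that
`… ≤ C ‖u‖_{L⁶_t L²_x} ‖∇ ⊗ u‖_{L²_t L²_x}`" — which needs `|u|² ∈ W^{1,1}(B)` with
`∇|u|² = 2 uᵀ∇u`, `‖∇|u|²‖_{L¹(B)} ≤ 2 ‖u‖_{L²(B)} ‖∇u‖_{L²(B)}`, for `u ∈ W^{1,2}(B)` (a
time slice of the energy class). This is the textbook product/chain rule for Sobolev functions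
(Evans, *PDE*, §5.2.3, Thm. 1 (iv) and Problem 17; Gilbarg–Trudinger, (7.18)). The tree's
`WeakNormSq.lean` (`HasWeakFDerivOn.norm_sq`, landed while this file was written) proves the same
rule on **bounded Lipschitz domains** through density of functions smooth up to the boundary;
the present file is the version on an **arbitrary open set** (interior Meyers–Serrin density),
which is the textbook generality, and shares no declaration with it (the two pointwise/Hölder
helpers that coincide are primed / suffixed here and carry twin notes).

Main results, on an open subset `Ω` of a finite-dimensional real inner product space with an
additive Haar measure `μ`, values in a real Hilbert space `F`:

* `hasWeakFDerivOn_norm_sq` — if `u ∈ L²(Ω; F)` has a weak derivative `G` on `Ω` with all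
  components `x ↦ G x v` in `L²(Ω)`, then `x ↦ ‖u x‖²` has the weak derivative
  `x ↦ (v ↦ 2 ⟪u x, G x v⟫)` (`= (2 : ℝ) • (innerSL ℝ (u x)).comp (G x)`) on `Ω`;
* `memSobolevDomain_one_norm_sq` — `|u|² ∈ W^{1,1}(Ω)` (the `L¹(Ω)` bound
  `‖2 ⟪u, G ·⟫‖_{L¹(Ω)} ≤ 2 ‖u‖_{L²(Ω)} ‖G‖_{L²(Ω)}` is the tree's
  `WeakNormSq.eLpNorm_two_smul_innerSL_comp_le`, re-proved privately here);
* tools: `exists_eLpNorm_sub_fderiv_le_eSobolevDomainNorm` (`‖g - Dφ‖_{L^p(Ω)} ≤ C ‖f - φ‖_{W^{1,p}(Ω)}`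
  for `φ` smooth on `Ω`) and `tendsto_eLpNorm_fderiv_of_tendsto_eSobolevDomainNorm_of_contDiffOn`
  (the `C^∞(Ω)`-twin of the tree's test-function version), `memLp_two_of_forall_apply`.

## Proof

Meyers–Serrin (`MeyersSerrin.exists_contDiffOn_tendsto_eSobolevDomainNorm_sub`) gives
`φₖ ∈ C^∞(Ω)` with `‖u - φₖ‖_{W^{1,2}(Ω)} → 0`; along a tail the norms are finite, so
`φₖ, Dφₖ ∈ L²(Ω)`, `φₖ → u` and `Dφₖ → G` in `L²(Ω)`. For each `k`,
`∫_Ω ∂ᵥη |φₖ|² = -∫_Ω η 2⟪φₖ, ∂ᵥφₖ⟫` is the classical identity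
(`MeyersSerrin.hasWeakFDerivOn_of_contDiffOn`, `HasFDerivAt.norm_sq`). Both sides pass to the limit
(`tendsto_setIntegral_smul_of_tendsto_eLpNorm`): `|φₖ|² - |u|² = ⟪φₖ - u, φₖ + u⟫ → 0` and
`⟪φₖ, ∂ᵥφₖ⟫ - ⟪u, G v⟫ = ⟪φₖ - u, ∂ᵥφₖ⟫ - ⟪u, (G - Dφₖ) v⟫ → 0` in `L¹(Ω)` by the Cauchy–Schwarz
and Hölder inequalities.

## References

* L. C. Evans, *Partial Differential Equations*, 2nd ed. (2010), §5.2.3 Thm. 1 (iv), §5.10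
  Problem 17 (chain rule in `W^{1,p}`).
* D. Gilbarg, N. Trudinger, *Elliptic Partial Differential Equations of Second Order*, §7.4,
  Lemma 7.5 and (7.18).
* P. G. Lemarié-Rieusset, *The Navier–Stokes Problem in the 21st Century*, CRC Press (2016),
  §13.9, p. 468. [LemarieRieusset2016]
-/

noncomputable section

open MeasureTheory TopologicalSpace Filter Set Metric Function
open scoped ENNReal NNReal Topology RealInnerProductSpace ContDiff

namespace Literature.Analysis.FunctionSpaces

variable {E' : Type*} [NormedAddCommGroup E'] [InnerProductSpace ℝ E'] [FiniteDimensional ℝ E']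
  [MeasurableSpace E'] [BorelSpace E']
variable {F : Type*} [NormedAddCommGroup F] [InnerProductSpace ℝ F] [CompleteSpace F]

/-! ### `Dφₖ → Du` in `L^p(Ω)` for functions smooth on `Ω` -/

/-- **`‖g - Dφ‖_{L^p(Ω)} ≤ C ‖f - φ‖_{W^{1,p}(Ω)}`** for `φ` smooth on `Ω` and any weak
derivative `g` of `f` on `Ω` (`1 ≤ p`): the infimum in the `W^{1,p}` norm of `f - φ` is over weak
derivatives of `f - φ`, all a.e. equal to `g - Dφ` (`HasWeakFDerivOn.unique_holds`,
`MeyersSerrin.hasWeakFDerivOn_of_contDiffOn`), and the operator norm is controlled by the values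
on a basis (`eLpNorm_le_mul_sum_eLpNorm_apply_basis`); `C` depends on `E'` only. Twin of the
estimate inside `tendsto_eLpNorm_fderiv_of_tendsto_eSobolevDomainNorm` (test functions). [folklore] -/
theorem exists_eLpNorm_sub_fderiv_le_eSobolevDomainNorm {p : ℝ≥0∞} (hp : 1 ≤ p) (Ω : Opens E')
    (μ : Measure E') [μ.IsAddHaarMeasure] :
    ∃ C : ℝ≥0, ∀ (f : E' → F) (g : E' → E' →L[ℝ] F) (φ : E' → F), HasWeakFDerivOn Ω μ f g →
      ContDiffOn ℝ ((⊤ : ℕ∞) : WithTop ℕ∞) φ Ω →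
      eLpNorm (fun x => g x - fderiv ℝ φ x) p (μ.restrict Ω) ≤ C * eSobolevDomainNorm 1 p Ω μ (f - φ) := by
  obtain ⟨Cb, hCb0, hCb⟩ := exists_opNorm_le_mul_sum_basis (F := F) (Module.finBasis ℝ E')
  refine ⟨Cb, fun f g φ hfg hφ => ?_⟩
  set I : ℝ≥0∞ := ⨅ (g' : E' → E' →L[ℝ] F) (_ : HasWeakFDerivOn Ω μ (f - φ) g'),
    ∑ i, eLpNorm (fun x => g' x (Module.finBasis ℝ E' i)) p (μ.restrict Ω) with hI_def
  have hI : I ≤ eSobolevDomainNorm 1 p Ω μ (f - φ) := by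
    rw [show eSobolevDomainNorm 1 p Ω μ (f - φ) = eLpNorm (f - φ) p (μ.restrict Ω) + I by
      simp [eSobolevDomainNorm, hI_def]]
    exact le_add_self
  have hφk : HasWeakFDerivOn Ω μ φ (fderiv ℝ φ) := MeyersSerrin.hasWeakFDerivOn_of_contDiffOn hφ
  have hd : HasWeakFDerivOn Ω μ (f - φ) (g - fderiv ℝ φ) := hfg.sub hφk
  have h1 : ∀ g', HasWeakFDerivOn Ω μ (f - φ) g' →
      eLpNorm (fun x => g x - fderiv ℝ φ x) p (μ.restrict Ω) ≤
        Cb * ∑ i, eLpNorm (fun x => g' x (Module.finBasis ℝ E' i)) p (μ.restrict Ω) := by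
    intro g' hg'
    have hae : g' =ᵐ[μ.restrict Ω] (g - fderiv ℝ φ) := HasWeakFDerivOn.unique_holds hg' hd
    calc eLpNorm (fun x => g x - fderiv ℝ φ x) p (μ.restrict Ω)
        = eLpNorm g' p (μ.restrict Ω) := (eLpNorm_congr_ae hae).symm
      _ ≤ Cb * ∑ i, eLpNorm (fun x => g' x (Module.finBasis ℝ E' i)) p (μ.restrict Ω) :=
        eLpNorm_le_mul_sum_eLpNorm_apply_basis (Module.finBasis ℝ E') hCb
          hg'.locallyIntegrableOn_deriv.aestronglyMeasurable hp
  calc eLpNorm (fun x => g x - fderiv ℝ φ x) p (μ.restrict Ω)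
      ≤ ⨅ (g' : E' → E' →L[ℝ] F) (_ : HasWeakFDerivOn Ω μ (f - φ) g'),
          Cb * ∑ i, eLpNorm (fun x => g' x (Module.finBasis ℝ E' i)) p (μ.restrict Ω) := le_iInf₂ h1
    _ = Cb * I := by
      simp only [hI_def]
      rw [ENNReal.mul_iInf_of_ne (by exact_mod_cast hCb0) ENNReal.coe_ne_top]
      refine iInf_congr fun g' => ?_
      rw [ENNReal.mul_iInf_of_ne (by exact_mod_cast hCb0) ENNReal.coe_ne_top]
    _ ≤ Cb * eSobolevDomainNorm 1 p Ω μ (f - φ) := by gcongr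

/-- Convergence `φₖ → f` in `W^{1,p}(Ω)` of functions **smooth on `Ω`** forces `Dφₖ → g` in
`L^p(Ω)` (operator norm) for any weak derivative `g` of `f` on `Ω` (twin of
`tendsto_eLpNorm_fderiv_of_tendsto_eSobolevDomainNorm`, which assumes test functions; the form
produced by the Meyers–Serrin theorem). [folklore] -/
theorem tendsto_eLpNorm_fderiv_of_tendsto_eSobolevDomainNorm_of_contDiffOn
    {p : ℝ≥0∞} (hp : 1 ≤ p) {Ω : Opens E'} {μ : Measure E'} [μ.IsAddHaarMeasure] {f : E' → F}
    {g : E' → E' →L[ℝ] F} (hfg : HasWeakFDerivOn Ω μ f g) {φ : ℕ → E' → F}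
    (hφ : ∀ k, ContDiffOn ℝ ((⊤ : ℕ∞) : WithTop ℕ∞) (φ k) Ω)
    (hlim : Tendsto (fun k => eSobolevDomainNorm 1 p Ω μ (f - φ k)) atTop (𝓝 0)) :
    Tendsto (fun k => eLpNorm (fun x => g x - fderiv ℝ (φ k) x) p (μ.restrict Ω)) atTop (𝓝 0) := by
  obtain ⟨C, hC⟩ := exists_eLpNorm_sub_fderiv_le_eSobolevDomainNorm (F := F) hp Ω μ
  have hCI : Tendsto (fun k => (C : ℝ≥0∞) * eSobolevDomainNorm 1 p Ω μ (f - φ k)) atTop (𝓝 0) := by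
    simpa using ENNReal.Tendsto.const_mul hlim (Or.inr ENNReal.coe_ne_top)
  exact tendsto_of_tendsto_of_tendsto_of_le_of_le tendsto_const_nhds hCI (fun _ => zero_le)
    fun k => hC f g (φ k) hfg (hφ k)

/-- If `aₖ → 0` in `[0, ∞]` and `bₖ ≤ B < ∞`, then `aₖ bₖ → 0`. [folklore] -/
theorem ENNReal.tendsto_zero_mul_of_le {a b : ℕ → ℝ≥0∞} {B : ℝ≥0∞} (ha : Tendsto a atTop (𝓝 0))
    (hb : ∀ k, b k ≤ B) (hB : B ≠ ⊤) : Tendsto (fun k => a k * b k) atTop (𝓝 0) := by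
  have h1 : Tendsto (fun k => a k * B) atTop (𝓝 0) := by
    simpa using ENNReal.Tendsto.mul_const ha (Or.inr hB)
  exact tendsto_of_tendsto_of_tendsto_of_le_of_le tendsto_const_nhds h1 (fun _ => zero_le)
    fun k => mul_le_mul_of_nonneg_left (hb k) (by positivity)

/-! ### Measurability and integrability of `x ↦ 2 ⟪u x, G x ·⟫` -/

omit [FiniteDimensional ℝ E'] [MeasurableSpace E'] [BorelSpace E'] [CompleteSpace F] in
/-- The pairing `(a, L) ↦ ⟪a, L ·⟫ = (innerSL a) ∘ L` is continuous. [folklore] -/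
theorem continuous_innerSL_comp :
    Continuous fun q : F × (E' →L[ℝ] F) => (innerSL ℝ q.1).comp q.2 :=
  ((innerSL ℝ (E := F)).continuous.comp continuous_fst).clm_comp continuous_snd

omit [FiniteDimensional ℝ E'] [MeasurableSpace E'] [BorelSpace E'] [CompleteSpace F] in
/-- `‖2 ⟪a, L ·⟫‖ ≤ 2 ‖a‖ ‖L‖`. Twin of `WeakNormSq.norm_two_smul_innerSL_comp_le` (not
imported: disjoint import closures). [folklore] -/
private theorem norm_two_smul_innerSL_comp_le' (a : F) (L : E' →L[ℝ] F) :
    ‖(2 : ℝ) • (innerSL ℝ a).comp L‖ ≤ 2 * (‖a‖ * ‖L‖) := by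
  rw [norm_smul, Real.norm_two]
  gcongr
  exact (ContinuousLinearMap.opNorm_comp_le _ _).trans (by rw [innerSL_apply_norm])

variable {Ω : Opens E'} {μ : Measure E'}

omit [BorelSpace E'] [CompleteSpace F] in
/-- An operator field with all components in `L²(Ω)` is in `L²(Ω)` (operator norm). [folklore] -/
theorem memLp_two_of_forall_apply {G : E' → E' →L[ℝ] F} (hGm : AEStronglyMeasurable G (μ.restrict Ω))
    (hG2 : ∀ v, MemLp (fun x => G x v) 2 (μ.restrict Ω)) : MemLp G 2 (μ.restrict Ω) := by
  obtain ⟨Cb, -, hCb⟩ := exists_opNorm_le_mul_sum_basis (F := F) (Module.finBasis ℝ E')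
  refine ⟨hGm, ?_⟩
  refine (eLpNorm_le_mul_sum_eLpNorm_apply_basis (Module.finBasis ℝ E') hCb hGm
    (by norm_num : (1 : ℝ≥0∞) ≤ 2)).trans_lt ?_
  exact ENNReal.mul_lt_top ENNReal.coe_lt_top
    (ENNReal.sum_lt_top.2 fun i _ => (hG2 _).eLpNorm_lt_top)

omit [FiniteDimensional ℝ E'] [BorelSpace E'] [CompleteSpace F] in
/-- Measurability of `x ↦ 2 ⟪u x, G x ·⟫` for measurable `u`, `G`. [folklore] -/
theorem aestronglyMeasurable_two_smul_innerSL_comp {u : E' → F} {G : E' → E' →L[ℝ] F}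
    (hu : AEStronglyMeasurable u (μ.restrict Ω)) (hG : AEStronglyMeasurable G (μ.restrict Ω)) :
    AEStronglyMeasurable (fun x => (2 : ℝ) • (innerSL ℝ (u x)).comp (G x)) (μ.restrict Ω) := by
  have h0 : AEStronglyMeasurable (fun x => (u x, G x)) (μ.restrict Ω) := hu.prodMk hG
  have h1 : AEStronglyMeasurable (fun x => (innerSL ℝ (u x)).comp (G x)) (μ.restrict Ω) :=
    continuous_innerSL_comp.comp_aestronglyMeasurable h0
  exact h1.const_smul (2 : ℝ)

omit [FiniteDimensional ℝ E'] [MeasurableSpace E'] [BorelSpace E'] [CompleteSpace F] in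
/-- `‖2 ⟪a, L ·⟫‖₊ ≤ 2 ‖a‖₊ ‖L‖₊`. [folklore] -/
private theorem nnnorm_two_smul_innerSL_comp_le' (a : F) (L : E' →L[ℝ] F) :
    ‖(2 : ℝ) • (innerSL ℝ a).comp L‖₊ ≤ 2 * ‖a‖₊ * ‖L‖₊ := by
  rw [← NNReal.coe_le_coe, NNReal.coe_mul, NNReal.coe_mul, coe_nnnorm, coe_nnnorm, coe_nnnorm,
    NNReal.coe_ofNat, mul_assoc]
  exact norm_two_smul_innerSL_comp_le' a L

omit [FiniteDimensional ℝ E'] [BorelSpace E'] [CompleteSpace F] in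
/-- Hölder: `‖2 ⟪u, G ·⟫‖_{L¹(Ω)} ≤ 2 ‖u‖_{L²(Ω)} ‖G‖_{L²(Ω)}` (measurability only; twin of
`WeakNormSq.eLpNorm_two_smul_innerSL_comp_le`, not imported). [folklore] -/
private theorem eLpNorm_two_smul_innerSL_comp_le_of_aestronglyMeasurable {u : E' → F} {G : E' → E' →L[ℝ] F}
    (hu : AEStronglyMeasurable u (μ.restrict Ω)) (hG : AEStronglyMeasurable G (μ.restrict Ω)) :
    eLpNorm (fun x => (2 : ℝ) • (innerSL ℝ (u x)).comp (G x)) 1 (μ.restrict Ω) ≤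
      2 * (eLpNorm u 2 (μ.restrict Ω) * eLpNorm G 2 (μ.restrict Ω)) := by
  have key := eLpNorm_le_eLpNorm_mul_eLpNorm_of_nnnorm (p := 2) (q := 2) (r := 1) hu hG
    (fun (a : F) (L : E' →L[ℝ] F) => (2 : ℝ) • (innerSL ℝ a).comp L) (2 : ℝ≥0)
    (Eventually.of_forall fun x => nnnorm_two_smul_innerSL_comp_le' (u x) (G x))
  rw [mul_assoc] at key
  exact key

omit [FiniteDimensional ℝ E'] [BorelSpace E'] [CompleteSpace F] in
/-- For `u, G ∈ L²(Ω)`, the field `x ↦ 2 ⟪u x, G x ·⟫` is integrable on `Ω`. [folklore] -/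
theorem integrable_two_smul_innerSL_comp {u : E' → F} {G : E' → E' →L[ℝ] F}
    (hu : MemLp u 2 (μ.restrict Ω)) (hG : MemLp G 2 (μ.restrict Ω)) :
    Integrable (fun x => (2 : ℝ) • (innerSL ℝ (u x)).comp (G x)) (μ.restrict Ω) := by
  have hM : MemLp (fun x => (2 : ℝ) • (innerSL ℝ (u x)).comp (G x)) 1 (μ.restrict Ω) :=
    ⟨aestronglyMeasurable_two_smul_innerSL_comp hu.1 hG.1,
      (eLpNorm_two_smul_innerSL_comp_le_of_aestronglyMeasurable hu.1 hG.1).trans_lt (ENNReal.mul_lt_top (by simp)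
        (ENNReal.mul_lt_top hu.eLpNorm_lt_top hG.eLpNorm_lt_top))⟩
  exact memLp_one_iff_integrable.1 hM

/-! ### The chain rule -/

omit [FiniteDimensional ℝ E'] [MeasurableSpace E'] [BorelSpace E'] [CompleteSpace F] in
/-- `‖a‖² - ‖b‖² = ⟪a - b, a + b⟫` in a real inner product space. [folklore] -/
theorem norm_sq_sub_norm_sq_eq_inner (a b : F) : ‖a‖ ^ 2 - ‖b‖ ^ 2 = ⟪a - b, a + b⟫ := by
  rw [inner_sub_left, inner_add_right, inner_add_right, real_inner_self_eq_norm_sq,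
    real_inner_self_eq_norm_sq, real_inner_comm a b]
  ring

omit [FiniteDimensional ℝ E'] [MeasurableSpace E'] [BorelSpace E'] [CompleteSpace F] in
/-- The classical derivative of `‖φ‖²` at an interior point of `Ω` for `φ` smooth on `Ω`:
`D(‖φ‖²)(x) v = 2 ⟪φ x, Dφ x v⟫`. [folklore] -/
theorem fderiv_norm_sq_apply_of_contDiffOn {Ω : Opens E'} {φ : E' → F}
    (hφ : ContDiffOn ℝ ((⊤ : ℕ∞) : WithTop ℕ∞) φ Ω) {x : E'} (hx : x ∈ (Ω : Set E')) (v : E') :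
    fderiv ℝ (fun y => ‖φ y‖ ^ 2) x v = 2 * ⟪φ x, fderiv ℝ φ x v⟫ := by
  have hd : DifferentiableAt ℝ φ x :=
    (hφ.differentiableOn (by simp)).differentiableAt (Ω.isOpen.mem_nhds hx)
  rw [(hd.hasFDerivAt.norm_sq).fderiv]
  simp [two_smul, two_mul]

variable [μ.IsAddHaarMeasure]

/-- **The chain rule `D|u|² = 2 ⟪u, Du⟫` for `u ∈ W^{1,2}(Ω)`** (Evans, *PDE*, §5.2.3,
Thm. 1 (iv) / problem 17: products and compositions of Sobolev functions; Gilbarg–Trudinger,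
Lemma 7.5 / (7.18); used e.g. in Lemarié-Rieusset 2016, p. 468, for `∇|u|²` with
`u ∈ L²_t H¹_x`). Let `Ω` be an open subset of a finite-dimensional real inner product space with
an additive Haar measure `μ`, `F` a real Hilbert space, `u ∈ L²(Ω; F)` with a weak derivative `G`
on `Ω` all of whose components `x ↦ G x v` lie in `L²(Ω)`. Then `x ↦ ‖u x‖²` has the weak
derivative `x ↦ (v ↦ 2 ⟪u x, G x v⟫)` on `Ω`. Proof: Meyers–Serrin approximation `φₖ → u` in
`W^{1,2}(Ω)` by functions smooth on `Ω` (`MeyersSerrin.exists_contDiffOn_tendsto_eSobolevDomainNorm_sub`);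
for each `k` the identity `∫_Ω ∂ᵥη ‖φₖ‖² = -∫_Ω η 2⟪φₖ, ∂ᵥφₖ⟫` is the classical one
(`MeyersSerrin.hasWeakFDerivOn_of_contDiffOn`), and both sides pass to the limit since
`‖φₖ‖² → ‖u‖²` and `⟪φₖ, ∂ᵥφₖ⟫ → ⟪u, G v⟫` in `L¹(Ω)` (Cauchy–Schwarz and Hölder). [folklore] -/
theorem hasWeakFDerivOn_norm_sq {u : E' → F} {G : E' → E' →L[ℝ] F}
    (hu : MemLp u 2 (μ.restrict Ω)) (hG : HasWeakFDerivOn Ω μ u G)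
    (hG2 : ∀ v, MemLp (fun x => G x v) 2 (μ.restrict Ω)) :
    HasWeakFDerivOn Ω μ (fun x => ‖u x‖ ^ 2) (fun x => (2 : ℝ) • (innerSL ℝ (u x)).comp (G x)) := by
  set ν := μ.restrict (Ω : Set E') with hν
  have hum : AEStronglyMeasurable u ν := hu.1
  have hGm : AEStronglyMeasurable G ν := hG.locallyIntegrableOn_deriv.aestronglyMeasurable
  have hGL2 : MemLp G 2 ν := memLp_two_of_forall_apply hGm hG2
  -- the two integrability classes of the statement
  have hsq : Integrable (fun x => ‖u x‖ ^ 2) ν := (memLp_two_iff_integrable_sq_norm hum).1 hu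
  have hD : Integrable (fun x => (2 : ℝ) • (innerSL ℝ (u x)).comp (G x)) ν :=
    integrable_two_smul_innerSL_comp hu hGL2
  have hsq' : IntegrableOn (fun x => ‖u x‖ ^ 2) (Ω : Set E') μ := hsq
  have hD' : IntegrableOn (fun x => (2 : ℝ) • (innerSL ℝ (u x)).comp (G x)) (Ω : Set E') μ := hD
  refine ⟨hsq'.locallyIntegrableOn, hD'.locallyIntegrableOn, fun η v hη => ?_⟩
  -- Meyers–Serrin approximation in `W^{1,2}(Ω)`
  have hW : MemSobolevDomain 1 2 Ω μ u :=
    (memSobolevDomain_succ_iff (k := 0)).2 ⟨hu, G, hG, fun w => (memSobolevDomain_zero_iff).2 (hG2 w)⟩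
  obtain ⟨φ₀, hφ₀s, hφ₀lim⟩ :=
    MeyersSerrin.exists_contDiffOn_tendsto_eSobolevDomainNorm_sub (by norm_num : (1 : ℝ≥0∞) ≤ 2)
      ENNReal.ofNat_ne_top hW
  -- pass to a tail along which the Sobolev norms are finite
  have hfin : ∀ᶠ k in atTop, eSobolevDomainNorm 1 2 Ω μ (u - φ₀ k) < ⊤ :=
    hφ₀lim.eventually (gt_mem_nhds ENNReal.zero_lt_top)
  obtain ⟨N, hN⟩ := eventually_atTop.1 hfin
  set φ : ℕ → E' → F := fun k => φ₀ (k + N) with hφdef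
  have hφs : ∀ k, ContDiffOn ℝ ((⊤ : ℕ∞) : WithTop ℕ∞) (φ k) Ω := fun k => hφ₀s (k + N)
  have hφlim : Tendsto (fun k => eSobolevDomainNorm 1 2 Ω μ (u - φ k)) atTop (𝓝 0) :=
    hφ₀lim.comp (tendsto_add_atTop_nat N)
  have hφfin : ∀ k, eSobolevDomainNorm 1 2 Ω μ (u - φ k) < ⊤ := fun k => hN (k + N) (by omega)
  -- measurability of the approximants and of their derivatives on `Ω`
  have hφm : ∀ k, AEStronglyMeasurable (φ k) ν := fun k =>
    (hφs k).continuousOn.aestronglyMeasurable Ω.isOpen.measurableSet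
  have hDφm : ∀ k, AEStronglyMeasurable (fderiv ℝ (φ k)) ν := fun k =>
    ((hφs k).continuousOn_fderiv_of_isOpen Ω.isOpen (by simp)).aestronglyMeasurable
      Ω.isOpen.measurableSet
  -- `φₖ → u` and `Dφₖ → G` in `L²(Ω)`
  have hL2 : Tendsto (fun k => eLpNorm (u - φ k) 2 ν) atTop (𝓝 0) :=
    tendsto_of_tendsto_of_tendsto_of_le_of_le tendsto_const_nhds hφlim (fun _ => zero_le)
      fun _ => eLpNorm_le_eSobolevDomainNorm
  have hDL2 : Tendsto (fun k => eLpNorm (fun x => G x - fderiv ℝ (φ k) x) 2 ν) atTop (𝓝 0) :=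
    tendsto_eLpNorm_fderiv_of_tendsto_eSobolevDomainNorm_of_contDiffOn (by norm_num) hG hφs hφlim
  -- the approximants are in `L²(Ω)`, with derivatives in `L²(Ω)`
  have hφL2 : ∀ k, MemLp (φ k) 2 ν := by
    intro k
    have h1 : MemLp (u - φ k) 2 ν :=
      ⟨hum.sub (hφm k), lt_of_le_of_lt eLpNorm_le_eSobolevDomainNorm (hφfin k)⟩
    have : φ k = u - (u - φ k) := by abel
    rw [this]
    exact hu.sub h1
  obtain ⟨C₁, hC₁⟩ := exists_eLpNorm_sub_fderiv_le_eSobolevDomainNorm (F := F)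
    (by norm_num : (1 : ℝ≥0∞) ≤ 2) Ω μ
  have hdiffL2 : ∀ k, MemLp (fun x => G x - fderiv ℝ (φ k) x) 2 ν := fun k =>
    ⟨hGm.sub (hDφm k), (hC₁ u G (φ k) hG (hφs k)).trans_lt
      (ENNReal.mul_lt_top ENNReal.coe_lt_top (hφfin k))⟩
  have hDφL2 : ∀ k, MemLp (fderiv ℝ (φ k)) 2 ν := by
    intro k
    have : fderiv ℝ (φ k) = G - fun x => G x - fderiv ℝ (φ k) x := by funext x; simp
    rw [this]
    exact hGL2.sub (hdiffL2 k)
  -- the identity for each approximant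
  have hstep : ∀ k, ∫ x in (Ω : Set E'), (fderiv ℝ η x v) • ‖φ k x‖ ^ 2 ∂μ =
      -∫ x in (Ω : Set E'), η x • (2 * ⟪φ k x, fderiv ℝ (φ k) x v⟫) ∂μ := by
    intro k
    have hw := (MeyersSerrin.hasWeakFDerivOn_of_contDiffOn (μ := μ)
      ((hφs k).norm_sq (𝕜 := ℝ))).integral_fderiv_smul_eq η v hη
    rw [hw]
    congr 1
    refine setIntegral_congr_fun Ω.isOpen.measurableSet fun x hx => ?_
    rw [fderiv_norm_sq_apply_of_contDiffOn (hφs k) hx v]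
  -- the test functions `∂ᵥη` and `η`
  have hψc : Continuous fun x => fderiv ℝ η x v :=
    (hη.contDiff.continuous_fderiv (by simp)).clm_apply continuous_const
  have hψs : HasCompactSupport fun x => fderiv ℝ η x v := hη.hasCompactSupport.fderiv_apply (𝕜 := ℝ) v
  have hψΩ : tsupport (fun x => fderiv ℝ η x v) ⊆ (Ω : Set E') :=
    (tsupport_fderiv_apply_subset ℝ v).trans hη.tsupport_subset
  -- left-hand sides: `‖φₖ‖² → ‖u‖²` in `L¹(Ω)`
  have hsqk : ∀ k, MemLp (fun x => ‖φ k x‖ ^ 2) 1 ν := fun k =>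
    memLp_one_iff_integrable.2 ((memLp_two_iff_integrable_sq_norm (hφm k)).1 (hφL2 k))
  have hsq1 : MemLp (fun x => ‖u x‖ ^ 2) 1 ν := memLp_one_iff_integrable.2 hsq
  have hlimL : Tendsto (fun k => eLpNorm ((fun x => ‖φ k x‖ ^ 2) - fun x => ‖u x‖ ^ 2) 1 ν) atTop
      (𝓝 0) := by
    have hbound : ∀ k, eLpNorm ((fun x => ‖φ k x‖ ^ 2) - fun x => ‖u x‖ ^ 2) 1 ν ≤
        eLpNorm (u - φ k) 2 ν * (eLpNorm (u - φ k) 2 ν + 2 * eLpNorm u 2 ν) := by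
      intro k
      have e : ((fun x => ‖φ k x‖ ^ 2) - fun x => ‖u x‖ ^ 2) =
          fun x => ⟪(φ k - u) x, (φ k + u) x⟫ := by
        funext x; simp only [Pi.sub_apply, Pi.add_apply]; exact norm_sq_sub_norm_sq_eq_inner _ _
      rw [e]
      have key := eLpNorm_le_eLpNorm_mul_eLpNorm_of_nnnorm (p := 2) (q := 2) (r := 1)
        ((hφm k).sub hum) ((hφm k).add hum) (fun (a : F) (b : F) => (⟪a, b⟫ : ℝ)) 1
        (Eventually.of_forall fun x => by simpa using nnnorm_inner_le_nnnorm ((φ k - u) x) ((φ k + u) x))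
      simp only [ENNReal.coe_one, one_mul] at key
      refine key.trans (mul_le_mul ?_ ?_ (by positivity) (by positivity))
      · rw [eLpNorm_sub_comm]
      · calc eLpNorm (φ k + u) 2 ν ≤ eLpNorm (φ k) 2 ν + eLpNorm u 2 ν :=
            eLpNorm_add_le (hφm k) hum (by norm_num)
          _ ≤ (eLpNorm (φ k - u) 2 ν + eLpNorm u 2 ν) + eLpNorm u 2 ν := by
              gcongr
              calc eLpNorm (φ k) 2 ν = eLpNorm ((φ k - u) + u) 2 ν := by rw [sub_add_cancel]
                _ ≤ eLpNorm (φ k - u) 2 ν + eLpNorm u 2 ν := eLpNorm_add_le ((hφm k).sub hum) hum (by norm_num)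
          _ = eLpNorm (u - φ k) 2 ν + 2 * eLpNorm u 2 ν := by rw [eLpNorm_sub_comm]; ring
    have hlim0 : Tendsto (fun k => eLpNorm (u - φ k) 2 ν * (eLpNorm (u - φ k) 2 ν + 2 * eLpNorm u 2 ν))
        atTop (𝓝 0) := by
      have h2 : Tendsto (fun k => eLpNorm (u - φ k) 2 ν + 2 * eLpNorm u 2 ν) atTop
          (𝓝 (0 + 2 * eLpNorm u 2 ν)) := hL2.add tendsto_const_nhds
      have hfin2 : (0 : ℝ≥0∞) + 2 * eLpNorm u 2 ν ≠ ⊤ := by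
        rw [zero_add]; exact ENNReal.mul_ne_top (by simp) hu.eLpNorm_ne_top
      simpa using ENNReal.Tendsto.mul hL2 (Or.inr hfin2) h2 (Or.inr ENNReal.zero_ne_top)
    exact tendsto_of_tendsto_of_tendsto_of_le_of_le tendsto_const_nhds hlim0 (fun _ => zero_le) hbound
  have hLHS : Tendsto (fun k => ∫ x in (Ω : Set E'), (fderiv ℝ η x v) • ‖φ k x‖ ^ 2 ∂μ) atTop
      (𝓝 (∫ x in (Ω : Set E'), (fderiv ℝ η x v) • ‖u x‖ ^ 2 ∂μ)) :=
    tendsto_setIntegral_smul_of_tendsto_eLpNorm le_rfl hψc hψs hψΩ hsqk hsq1 hlimL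
  -- right-hand sides: `⟪φₖ, ∂ᵥφₖ⟫ → ⟪u, G v⟫` in `L¹(Ω)`
  have happly : ∀ (L : E' → E' →L[ℝ] F), AEStronglyMeasurable L ν →
      AEStronglyMeasurable (fun x => L x v) ν := fun L hL =>
    (ContinuousLinearMap.apply ℝ F v).continuous.comp_aestronglyMeasurable hL
  have hinnerL1 : ∀ (a : E' → F) (c : E' → F), MemLp a 2 ν → MemLp c 2 ν →
      MemLp (fun x => (⟪a x, c x⟫ : ℝ)) 1 ν ∧
        eLpNorm (fun x => (⟪a x, c x⟫ : ℝ)) 1 ν ≤ eLpNorm a 2 ν * eLpNorm c 2 ν := by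
    intro a c ha hc
    have key := eLpNorm_le_eLpNorm_mul_eLpNorm_of_nnnorm (p := 2) (q := 2) (r := 1) ha.1 hc.1
      (fun (x : F) (y : F) => (⟪x, y⟫ : ℝ)) 1
      (Eventually.of_forall fun x => by simpa using nnnorm_inner_le_nnnorm (a x) (c x))
    simp only [ENNReal.coe_one, one_mul] at key
    exact ⟨⟨ha.1.inner hc.1, key.trans_lt (ENNReal.mul_lt_top ha.eLpNorm_lt_top hc.eLpNorm_lt_top)⟩,
      key⟩
  have hGv : MemLp (fun x => G x v) 2 ν := hG2 v
  have hLv : ∀ (L : E' → E' →L[ℝ] F), MemLp L 2 ν → MemLp (fun x => L x v) 2 ν ∧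
      eLpNorm (fun x => L x v) 2 ν ≤ ‖v‖₊ • eLpNorm L 2 ν := by
    intro L hL
    have hb : ∀ x, ‖L x v‖₊ ≤ ‖v‖₊ * ‖L x‖₊ := fun x => by
      rw [mul_comm]; exact ContinuousLinearMap.le_opNNNorm _ _
    exact ⟨MemLp.of_le_mul hL (happly L hL.1) (Eventually.of_forall fun x => by
        have := hb x
        rw [← NNReal.coe_le_coe] at this; push_cast at this; exact this),
      eLpNorm_le_nnreal_smul_eLpNorm_of_ae_le_mul (Eventually.of_forall hb) 2⟩
  have hGv : MemLp (fun x => G x v) 2 ν := hG2 v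
  have hDφv : ∀ k, MemLp (fun x => fderiv ℝ (φ k) x v) 2 ν := fun k => (hLv _ (hDφL2 k)).1
  have hdiffv : ∀ k, MemLp (fun x => (G x - fderiv ℝ (φ k) x) v) 2 ν := fun k =>
    (hLv (fun x => G x - fderiv ℝ (φ k) x) (hdiffL2 k)).1
  have hdiffv_lim : Tendsto (fun k => eLpNorm (fun x => (G x - fderiv ℝ (φ k) x) v) 2 ν) atTop (𝓝 0) := by
    have h1 : Tendsto (fun k => ‖v‖₊ • eLpNorm (fun x => G x - fderiv ℝ (φ k) x) 2 ν) atTop (𝓝 0) := by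
      simpa [ENNReal.smul_def] using ENNReal.Tendsto.const_mul hDL2 (Or.inr ENNReal.coe_ne_top)
    exact tendsto_of_tendsto_of_tendsto_of_le_of_le tendsto_const_nhds h1 (fun _ => zero_le)
      fun k => (hLv (fun x => G x - fderiv ℝ (φ k) x) (hdiffL2 k)).2
  -- the right-hand integrands
  set fR : ℕ → E' → ℝ := fun k x => 2 * ⟪φ k x, fderiv ℝ (φ k) x v⟫ with hfR
  set gR : E' → ℝ := fun x => 2 * ⟪u x, G x v⟫ with hgR
  have hfR1 : ∀ k, MemLp (fR k) 1 ν := fun k => ((hinnerL1 _ _ (hφL2 k) (hDφv k)).1).const_mul 2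
  have hgR1 : MemLp gR 1 ν := ((hinnerL1 _ _ hu hGv).1).const_mul 2
  have hlimR : Tendsto (fun k => eLpNorm (fR k - gR) 1 ν) atTop (𝓝 0) := by
    -- pointwise decomposition `fR k - gR = 2 (⟪φₖ - u, ∂ᵥφₖ⟫ - ⟪u, (G - Dφₖ) v⟫)`
    set A : ℕ → E' → ℝ := fun k x => ⟪(φ k - u) x, fderiv ℝ (φ k) x v⟫ with hA
    set B : ℕ → E' → ℝ := fun k x => ⟪u x, (G x - fderiv ℝ (φ k) x) v⟫ with hB
    have hsubv : ∀ L L' : E' →L[ℝ] F, (L - L') v = L v - L' v := fun _ _ => rfl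
    have e : ∀ k, fR k - gR = fun x => (2 : ℝ) • (A k - B k) x := by
      intro k; funext x
      simp only [hfR, hgR, hA, hB, Pi.sub_apply, hsubv, inner_sub_left,
        inner_sub_right, smul_eq_mul]
      ring
    have hAk : ∀ k, MemLp (A k) 1 ν ∧ eLpNorm (A k) 1 ν ≤
        eLpNorm (φ k - u) 2 ν * eLpNorm (fun x => fderiv ℝ (φ k) x v) 2 ν := fun k =>
      hinnerL1 (φ k - u) (fun x => fderiv ℝ (φ k) x v) ((hφL2 k).sub hu) (hDφv k)
    have hBk : ∀ k, MemLp (B k) 1 ν ∧ eLpNorm (B k) 1 ν ≤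
        eLpNorm u 2 ν * eLpNorm (fun x => (G x - fderiv ℝ (φ k) x) v) 2 ν := fun k =>
      hinnerL1 u (fun x => (G x - fderiv ℝ (φ k) x) v) hu (hdiffv k)
    have hDφv_le : ∀ k, eLpNorm (fun x => fderiv ℝ (φ k) x v) 2 ν ≤
        eLpNorm (fun x => G x v) 2 ν + eLpNorm (fun x => (G x - fderiv ℝ (φ k) x) v) 2 ν := by
      intro k
      have e2 : (fun x => fderiv ℝ (φ k) x v) =
          (fun x => G x v) - fun x => (G x - fderiv ℝ (φ k) x) v := by
        funext x; simp
      rw [e2]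
      exact eLpNorm_sub_le (happly G hGm) (hdiffv k).1 (by norm_num)
    have hbound : ∀ k, eLpNorm (fR k - gR) 1 ν ≤
        2 * (eLpNorm (u - φ k) 2 ν * (eLpNorm (fun x => G x v) 2 ν +
          eLpNorm (fun x => (G x - fderiv ℝ (φ k) x) v) 2 ν) +
          eLpNorm u 2 ν * eLpNorm (fun x => (G x - fderiv ℝ (φ k) x) v) 2 ν) := by
      intro k
      rw [e k, show (fun x => (2 : ℝ) • (A k - B k) x) = (2 : ℝ) • (A k - B k) from rfl,
        eLpNorm_const_smul, show ‖(2 : ℝ)‖ₑ = 2 by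
          rw [Real.enorm_eq_ofReal zero_le_two, ENNReal.ofReal_ofNat]]
      gcongr
      calc eLpNorm (A k - B k) 1 ν ≤ eLpNorm (A k) 1 ν + eLpNorm (B k) 1 ν :=
            eLpNorm_sub_le (hAk k).1.1 (hBk k).1.1 le_rfl
        _ ≤ eLpNorm (φ k - u) 2 ν * eLpNorm (fun x => fderiv ℝ (φ k) x v) 2 ν +
            eLpNorm u 2 ν * eLpNorm (fun x => (G x - fderiv ℝ (φ k) x) v) 2 ν :=
            add_le_add (hAk k).2 (hBk k).2
        _ ≤ _ := by
            rw [eLpNorm_sub_comm]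
            gcongr
            exact hDφv_le k
    have hlim0 : Tendsto (fun k => 2 * (eLpNorm (u - φ k) 2 ν * (eLpNorm (fun x => G x v) 2 ν +
          eLpNorm (fun x => (G x - fderiv ℝ (φ k) x) v) 2 ν) +
          eLpNorm u 2 ν * eLpNorm (fun x => (G x - fderiv ℝ (φ k) x) v) 2 ν)) atTop (𝓝 0) := by
      have h1 : Tendsto (fun k => eLpNorm (u - φ k) 2 ν * (eLpNorm (fun x => G x v) 2 ν +
          eLpNorm (fun x => (G x - fderiv ℝ (φ k) x) v) 2 ν)) atTop (𝓝 0) := by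
        have h2 : Tendsto (fun k => eLpNorm (fun x => G x v) 2 ν +
            eLpNorm (fun x => (G x - fderiv ℝ (φ k) x) v) 2 ν) atTop
            (𝓝 (eLpNorm (fun x => G x v) 2 ν + 0)) := tendsto_const_nhds.add hdiffv_lim
        have hfin2 : eLpNorm (fun x => G x v) 2 ν + 0 ≠ ⊤ := by
          rw [add_zero]; exact hGv.eLpNorm_ne_top
        simpa using ENNReal.Tendsto.mul hL2 (Or.inr hfin2) h2 (Or.inr ENNReal.zero_ne_top)
      have h3 : Tendsto (fun k => eLpNorm u 2 ν * eLpNorm (fun x => (G x - fderiv ℝ (φ k) x) v) 2 ν)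
          atTop (𝓝 0) := by
        simpa using ENNReal.Tendsto.const_mul hdiffv_lim (Or.inr hu.eLpNorm_ne_top)
      simpa using ENNReal.Tendsto.const_mul (h1.add h3) (Or.inr (by simp : (2 : ℝ≥0∞) ≠ ⊤))
    exact tendsto_of_tendsto_of_tendsto_of_le_of_le tendsto_const_nhds hlim0 (fun _ => zero_le) hbound
  have hRHS : Tendsto (fun k => ∫ x in (Ω : Set E'), η x • fR k x ∂μ) atTop
      (𝓝 (∫ x in (Ω : Set E'), η x • gR x ∂μ)) :=
    tendsto_setIntegral_smul_of_tendsto_eLpNorm le_rfl hη.contDiff.continuous hη.hasCompactSupport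
      hη.tsupport_subset hfR1 hgR1 hlimR
  -- conclude
  have hRHS' : Tendsto (fun k => ∫ x in (Ω : Set E'), (fderiv ℝ η x v) • ‖φ k x‖ ^ 2 ∂μ) atTop
      (𝓝 (-∫ x in (Ω : Set E'), η x • gR x ∂μ)) :=
    hRHS.neg.congr fun k => (hstep k).symm
  rw [tendsto_nhds_unique hLHS hRHS']
  rfl

/-- **`|u|² ∈ W^{1,1}(Ω)` for `u ∈ W^{1,2}(Ω)`**, with the weak derivative `2 ⟪u, Du⟫` of
`hasWeakFDerivOn_norm_sq` (whose `L¹(Ω)` norm is at most `2 ‖u‖_{L²(Ω)} ‖Du‖_{L²(Ω)}`,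
`WeakNormSq.eLpNorm_two_smul_innerSL_comp_le` in the tree): the form consumed by the Poincaré–Sobolev inequality for
`p = 1` (Lemarié-Rieusset 2016, p. 468: "`(∫_{B} ||u|² - Γ|^{3/2})^{2/3} ≤ C ∫_B |∇|u|²| dy`
… `≤ C ‖u‖_{L⁶_t L²_x} ‖∇ ⊗ u‖_{L²_t L²_x}`"). [folklore] -/
theorem memSobolevDomain_one_norm_sq {u : E' → F} {G : E' → E' →L[ℝ] F}
    (hu : MemLp u 2 (μ.restrict Ω)) (hG : HasWeakFDerivOn Ω μ u G)
    (hG2 : ∀ v, MemLp (fun x => G x v) 2 (μ.restrict Ω)) :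
    MemSobolevDomain 1 1 Ω μ (fun x => ‖u x‖ ^ 2) := by
  refine (memSobolevDomain_succ_iff (k := 0)).2 ⟨?_, _, hasWeakFDerivOn_norm_sq hu hG hG2, fun v => ?_⟩
  · exact memLp_one_iff_integrable.2 ((memLp_two_iff_integrable_sq_norm hu.1).1 hu)
  · rw [memSobolevDomain_zero_iff]
    change MemLp (fun x => (2 : ℝ) * ⟪u x, G x v⟫) 1 (μ.restrict Ω)
    have key := eLpNorm_le_eLpNorm_mul_eLpNorm_of_nnnorm (p := 2) (q := 2) (r := 1) hu.1 (hG2 v).1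
      (fun (x : F) (y : F) => (⟪x, y⟫ : ℝ)) 1
      (Eventually.of_forall fun x => by simpa using nnnorm_inner_le_nnnorm (u x) (G x v))
    have h1 : MemLp (fun x => (⟪u x, G x v⟫ : ℝ)) 1 (μ.restrict Ω) :=
      ⟨hu.1.inner (hG2 v).1, key.trans_lt (by
        simpa using ENNReal.mul_lt_top hu.eLpNorm_lt_top (hG2 v).eLpNorm_lt_top)⟩
    exact h1.const_mul 2

end Literature.Analysis.FunctionSpaces
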